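import Summits.BirchSwinnertonDyer.BirchSwinnertonDyer.Theorems.ClassRecordThreeEulerHalvesAtThreeCartanSupplyMonomialCuspZN
import HarnessLib

/-!
# VIRTUAL REALISATION over a cyclotomic field, V — the cuspidal case, second summand: `Ind_{T_C}^G θ`

Helper file riding `--supports stmt-BirchSwinnertonDyer-19109` (crux `EulerHalvesAtThree`; UNREGISTERED sub-line `Cruxes/EulerHalvesAtThree/Lines/cartan_corr`,
seat `bsd-idea-10` g13). `T_C = torusSubgroup η` is the non-split torus (cyclic of order `q² − 1`), `θ` its cubic character (file II, `3 ∣ q² − 1`).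
The character of the monomial representation `Ind_{T_C}^G θ`, class by class (Frobenius formula of file I): scalar `q(q − 1)` (`torusInd_scalar`, scalars are
cubes when `q ≡ 2 (3)`), `0` on non-scalar classes with a rational eigenvalue (`torusInd_of_hasRatEigenvalue`), and on an elliptic class
`θ(e) + θ(e)⁻¹ = 2 ∕ −1` according as `g^{(q²−1)/3}` is `1` or not (`torusInd_elliptic`: the class meets `T_C` in `{e, tr(e)·1 − e}`, a pair of
mutually inverse elements up to the cube `det(e)·1`).
HONEST FRAMING: finite-group character computation; nothing about NUM, crux 23422 ∕ 19109 or any summit statement is proved by this seat; BSD is proved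
for no curve. [folklore; cite: Bump1997 §4.1]
-/

set_option linter.dupNamespace false
set_option autoImplicit false

noncomputable section

namespace Summit.BirchSwinnertonDyer.BirchSwinnertonDyer.Theorems.CartanSupply.Monomial

open Summit.BirchSwinnertonDyer.BirchSwinnertonDyer.Theorems.CartanDegree
open Summit.BirchSwinnertonDyer.BirchSwinnertonDyer.Theorems.CartanTorusCubeCut
open scoped Classical

variable {q : ℕ} [Fact q.Prime] {k : Type*} [Field k] {ζ : kˣ} (hζ : IsPrimitiveRoot ζ 3) {η : Mat q}

/-! ## §1 The cubic character `θ` of the non-split torus -/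

/-- PROVED: `3 ∣ |T_C| = q² − 1` for `q ≥ 5`. [folklore] -/
theorem three_dvd_card_torus (hη : ¬ HasRatEigenvalue η) (hq5 : 5 ≤ q) : 3 ∣ Fintype.card ↥(torusSubgroup η) := by
  rw [card_torusSubgroup hη]; exact three_dvd_torus_order hq5

/-- the cubic character `θ : T_C → kˣ` (generator ↦ `ζ`). -/
def torusCubic (hη : ¬ HasRatEigenvalue η) (hq5 : 5 ≤ q) : ↥(torusSubgroup η) →* kˣ :=
  cubicChar (torusSubgroup_isCyclic hη) hζ (three_dvd_card_torus hη hq5)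

/-- the weight character `θ : T_C → k`. -/
def torusChar (hη : ¬ HasRatEigenvalue η) (hq5 : 5 ≤ q) : ↥(torusSubgroup η) →* k := (Units.coeHom k).comp (torusCubic hζ hη hq5)

/-- PROVED: unfolding `torusChar`. [folklore] -/
theorem torusChar_apply (hη : ¬ HasRatEigenvalue η) (hq5 : 5 ≤ q) (x : torusSubgroup η) :
    torusChar hζ hη hq5 x = ((torusCubic hζ hη hq5 x : kˣ) : k) := rfl

/-- PROVED: **`θ(x) = 1 ↔ x^{(q²−1)/3} = 1`** (as a matrix). [folklore] -/
theorem torusCubic_eq_one_iff (hη : ¬ HasRatEigenvalue η) (hq5 : 5 ≤ q) (x : torusSubgroup η) :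
    torusCubic hζ hη hq5 x = 1 ↔ ((x : G q) : Mat q) ^ ((q - 1) * (q + 1) / 3) = 1 := by
  unfold torusCubic
  rw [cubicChar_eq_one_iff_pow, card_torusSubgroup hη, Subtype.ext_iff, Subgroup.coe_pow, Subgroup.coe_one, Units.ext_iff,
    Units.val_pow_eq_pow_val, Units.val_one]

/-- PROVED: scalars of `T_C` are cubes: `θ(z) = 1` (`q ≡ 2 (3)`). [folklore] -/
theorem torusCubic_scalar (hη : ¬ HasRatEigenvalue η) (hq5 : 5 ≤ q) (hq3 : q % 3 = 2) (x : torusSubgroup η)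
    (hs : IsScalarMat ((x : G q) : Mat q)) : torusCubic hζ hη hq5 x = 1 :=
  (torusCubic_eq_one_iff hζ hη hq5 x).2 (scalar_pow_eq_one hq3 hs)

/-- PROVED: `|T_C| = (q−1)(q+1)` as `Nat.card`, cast into `k`. [folklore] -/
theorem card_torus_cast (hη : ¬ HasRatEigenvalue η) : (Nat.card (torusSubgroup η) : k) = ((q : k) - 1) * ((q : k) + 1) := by
  rw [Nat.card_eq_fintype_card, card_torusSubgroup hη, Nat.cast_mul, Nat.cast_sub (Fact.out : q.Prime).one_lt.le, Nat.cast_one,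
    Nat.cast_add, Nat.cast_one]

/-- PROVED: `|T_C| ≠ 0` in characteristic `0`. [folklore] -/
theorem card_torus_ne_zero [CharZero k] (hη : ¬ HasRatEigenvalue η) : (Nat.card (torusSubgroup η) : k) ≠ 0 := by
  rw [Nat.card_eq_fintype_card, card_torusSubgroup hη]
  exact Nat.cast_ne_zero.2 (mul_ne_zero (Nat.sub_ne_zero_of_lt (Fact.out : q.Prime).one_lt) (Nat.succ_ne_zero q))

/-! ## §2 The character of `Ind_{T_C}^G θ` on scalar and on rational-eigenvalue classes -/

/-- PROVED — **SCALAR**: `χ_B(z) = q(q−1)`. [folklore] -/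
theorem torusInd_scalar [CharZero k] (hη : ¬ HasRatEigenvalue η) (hq5 : 5 ≤ q) (hq3 : q % 3 = 2) {g : G q} (hs : IsScalarMat (g : Mat q)) :
    (monRep (torusSubgroup η) (torusChar hζ hη hq5)).character g = (q : k) * ((q : k) - 1) := by
  have key := frobenius_GL (torusSubgroup η) (torusChar hζ hη hq5) g
  have hC : (Finset.univ.filter fun x : G q => x⁻¹ * g * x = g) = Finset.univ :=
    Finset.filter_true_of_mem (fun x _ => NormOne.conj_of_isScalar g x hs)
  have hcl : (Finset.univ.filter fun y : G q => ∃ x : G q, x⁻¹ * g * x = y) = {g} := by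
    ext y
    simp only [Finset.mem_filter, Finset.mem_univ, true_and, Finset.mem_singleton]
    constructor
    · rintro ⟨x, hx⟩; rw [NormOne.conj_of_isScalar g x hs] at hx; exact hx.symm
    · rintro rfl; exact ⟨1, by simp⟩
  have hgE : g ∈ torusSubgroup η := mem_nonsplitTorus_iff.1 (NormOne.mem_nonsplitTorus_of_isScalar η hs)
  have hwt : wt (torusSubgroup η) (torusChar hζ hη hq5) g = 1 := by
    rw [wt_of_mem _ _ hgE, torusChar_apply, torusCubic_scalar hζ hη hq5 hq3 ⟨g, hgE⟩ hs, Units.val_one]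
  rw [hC, hcl, Finset.sum_singleton, Finset.card_univ, hwt, mul_one, card_G_cast] at key
  apply mul_left_cancel₀ (card_torus_ne_zero (k := k) hη)
  rw [key, card_torus_cast hη]; ring

/-- PROVED — **PARABOLIC or SPLIT** (non-scalar with a rational eigenvalue): `χ_B(g) = 0`, since non-scalar elements of `T_C` are elliptic. [folklore] -/
theorem torusInd_of_hasRatEigenvalue [CharZero k] (hη : ¬ HasRatEigenvalue η) (hq5 : 5 ≤ q) {g : G q} (hns : ¬ IsScalarMat (g : Mat q))
    (hr : HasRatEigenvalue (g : Mat q)) : (monRep (torusSubgroup η) (torusChar hζ hη hq5)).character g = 0 := by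
  have key := frobenius_GL (torusSubgroup η) (torusChar hζ hη hq5) g
  have hsum : ∑ y ∈ Finset.univ.filter (fun y : G q => ∃ x : G q, x⁻¹ * g * x = y), wt (torusSubgroup η) (torusChar hζ hη hq5) y = 0 := by
    refine Finset.sum_eq_zero (fun y hy => ?_)
    obtain ⟨x, rfl⟩ := (Finset.mem_filter.1 hy).2
    refine wt_of_not_mem _ _ (fun hE => ?_)
    have hns' : ¬ IsScalarMat ((x⁻¹ * g * x : G q) : Mat q) := by rwa [NormOne.isScalarMat_conj]
    exact NormOne.nonsplitTorus_types hη (mem_nonsplitTorus_iff.2 hE) hns' (by rwa [NormOne.hasRatEigenvalue_conj])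
  rw [hsum, mul_zero] at key
  exact (mul_eq_zero.1 key).resolve_left (card_torus_ne_zero hη)

/-! ## §3 The elliptic classes: `cl(g) ∩ T_C = {e, tr(e)·1 − e}` -/

/-- PROVED: `det(tr M · 1 − M) = det M`. [folklore] -/
theorem det_partner (M : Mat q) : (M.trace • (1 : Mat q) - M).det = M.det := by
  simp only [Matrix.det_fin_two, Matrix.trace_fin_two, Matrix.sub_apply, Matrix.smul_apply, Matrix.one_apply_eq,
    Matrix.one_apply_ne (show (0 : Fin 2) ≠ 1 by decide), Matrix.one_apply_ne (show (1 : Fin 2) ≠ 0 by decide), smul_eq_mul, mul_one,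
    mul_zero, zero_sub]
  ring

/-- PROVED: `tr(tr M · 1 − M) = tr M`. [folklore] -/
theorem trace_partner (M : Mat q) : (M.trace • (1 : Mat q) - M).trace = M.trace := by
  simp only [Matrix.trace_fin_two, Matrix.sub_apply, Matrix.smul_apply, Matrix.one_apply_eq, smul_eq_mul, mul_one]
  ring

/-- PROVED: `(tr M · 1 − M) · M = det M · 1` (Cayley–Hamilton). [folklore] -/
theorem partner_mul (M : Mat q) : (M.trace • (1 : Mat q) - M) * M = M.det • (1 : Mat q) := by
  rw [sub_mul, smul_mul_assoc, one_mul, NormOne.mul_self_eq, sub_sub_cancel]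

/-- PROVED: `tr M · 1 − M` is scalar iff `M` is. [folklore] -/
theorem isScalarMat_partner (M : Mat q) : IsScalarMat (M.trace • (1 : Mat q) - M) ↔ IsScalarMat M := by
  simp only [IsScalarMat, Matrix.sub_apply, Matrix.smul_apply, Matrix.one_apply_eq, Matrix.one_apply_ne (show (0 : Fin 2) ≠ 1 by decide),
    Matrix.one_apply_ne (show (1 : Fin 2) ≠ 0 by decide), smul_eq_mul, mul_one, mul_zero, zero_sub, neg_eq_zero, sub_right_inj]

/-- the partner `e' = tr(e)·1 − e` of an invertible matrix, as an element of `GL₂`. -/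
def partner (e : G q) : G q :=
  Matrix.GeneralLinearGroup.mkOfDetNeZero ((e : Mat q).trace • (1 : Mat q) - (e : Mat q))
    (by rw [det_partner]; exact Matrix.GeneralLinearGroup.det_ne_zero e)

/-- PROVED: the matrix of the partner. [folklore] -/
theorem partner_coe (e : G q) : ((partner e : G q) : Mat q) = (e : Mat q).trace • (1 : Mat q) - (e : Mat q) := rfl

/-- PROVED: the partner of an element of `T_C` lies in `T_C`. [folklore] -/
theorem partner_mem {e : G q} (he : e ∈ torusSubgroup η) : partner e ∈ torusSubgroup η := by
  rw [mem_torusSubgroup] at he ⊢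
  rw [partner_coe, sub_mul, mul_sub, smul_mul_assoc, one_mul, Matrix.mul_smul, mul_one, he]

/-- PROVED: the partner of a conjugate of `g` is a conjugate of `g` (`g` non-scalar). [folklore] -/
theorem partner_conj {g e : G q} (hns : ¬ IsScalarMat (g : Mat q)) (he : ∃ x : G q, x⁻¹ * g * x = e) : ∃ x : G q, x⁻¹ * g * x = partner e := by
  obtain ⟨hnse, hte, hde⟩ := (NormOne.conj_iff g e hns).1 he
  refine (NormOne.conj_iff g (partner e) hns).2 ⟨?_, ?_, ?_⟩
  · rw [partner_coe, isScalarMat_partner]; exact hnse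
  · rw [partner_coe, trace_partner, hte]
  · rw [partner_coe, det_partner, hde]

/-- PROVED: the partner differs from `e` when `e` is non-scalar and `q` is odd. [folklore] -/
theorem partner_ne (hq2 : q ≠ 2) {e : G q} (hns : ¬ IsScalarMat (e : Mat q)) : partner e ≠ e := by
  intro h
  have h2 : (2 : ZMod q) ≠ 0 := (ManinLocalTwoThree.SL2ZModOddPrime.neZero_two hq2).out
  have hM : (e : Mat q).trace • (1 : Mat q) - (e : Mat q) = (e : Mat q) := by rw [← partner_coe, h]
  apply hns
  have h01 : (e : Mat q) 0 1 = 0 := by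
    have := congrFun (congrFun hM 0) 1
    simp only [Matrix.sub_apply, Matrix.smul_apply, Matrix.one_apply_ne (show (0 : Fin 2) ≠ 1 by decide), smul_eq_mul, mul_zero,
      zero_sub] at this
    have h2x : (2 : ZMod q) * (e : Mat q) 0 1 = 0 := by linear_combination -this
    exact (mul_eq_zero.1 h2x).resolve_left h2
  have h10 : (e : Mat q) 1 0 = 0 := by
    have := congrFun (congrFun hM 1) 0
    simp only [Matrix.sub_apply, Matrix.smul_apply, Matrix.one_apply_ne (show (1 : Fin 2) ≠ 0 by decide), smul_eq_mul, mul_zero,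
      zero_sub] at this
    have h2x : (2 : ZMod q) * (e : Mat q) 1 0 = 0 := by linear_combination -this
    exact (mul_eq_zero.1 h2x).resolve_left h2
  have h00 : (e : Mat q) 0 0 = (e : Mat q) 1 1 := by
    have e0 := congrFun (congrFun hM 0) 0
    simp only [Matrix.sub_apply, Matrix.smul_apply, Matrix.one_apply_eq, smul_eq_mul, mul_one, Matrix.trace_fin_two] at e0
    linear_combination -e0
  exact ⟨h01, h10, h00⟩

/-- PROVED: `θ(e') · θ(e) = 1`: the product `e' e = det(e)·1` is a scalar of `T_C`, hence a cube (`q ≡ 2 (3)`). [folklore] -/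
theorem torusCubic_partner (hη : ¬ HasRatEigenvalue η) (hq5 : 5 ≤ q) (hq3 : q % 3 = 2) {e : G q} (he : e ∈ torusSubgroup η) :
    torusCubic hζ hη hq5 ⟨partner e, partner_mem he⟩ = (torusCubic hζ hη hq5 ⟨e, he⟩)⁻¹ := by
  apply eq_inv_of_mul_eq_one_left
  rw [← map_mul]
  apply torusCubic_scalar hζ hη hq5 hq3
  show IsScalarMat (((partner e * e : G q)) : Mat q)
  rw [Units.val_mul, partner_coe, partner_mul]
  refine ⟨?_, ?_, ?_⟩ <;> simp [Matrix.smul_apply, Matrix.one_apply_ne]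

/-- PROVED: **`χ_B` on an elliptic class**: `χ_B(g) = θ(e) + θ(e)⁻¹` for any `e ∈ cl(g) ∩ T_C`, i.e.
`= 2` if `g^{(q²−1)/3} = 1` and `= −1` otherwise. [folklore] -/
theorem torusInd_elliptic [CharZero k] (hq2 : q ≠ 2) (hη : ¬ HasRatEigenvalue η) (hq5 : 5 ≤ q) (hq3 : q % 3 = 2) {g : G q}
    (hg : ¬ HasRatEigenvalue (g : Mat q)) :
    (monRep (torusSubgroup η) (torusChar hζ hη hq5)).character g = if (g : Mat q) ^ ((q - 1) * (q + 1) / 3) = 1 then 2 else -1 := by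
  have hns : ¬ IsScalarMat (g : Mat q) := fun hs => hg (NormOne.hasRatEigenvalue_of_discr_eq_zero hq2 (PS.discr_eq_zero_of_isScalar hs))
  -- an element `e` of `cl(g) ∩ T_C`
  set S := (nonsplitTorus η).filter fun x => ∃ y : G q, y⁻¹ * g * y = x with hS
  have hScard : S.card = 2 := NormOne.card_nonsplitTorus_conj_of_elliptic hq2 hη g hg
  obtain ⟨e, heS⟩ := Finset.card_pos.1 (by rw [hScard]; exact Nat.zero_lt_two)
  obtain ⟨heT, x, hx⟩ := Finset.mem_filter.1 heS
  have heE : e ∈ torusSubgroup η := mem_nonsplitTorus_iff.1 heT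
  have hnse : ¬ IsScalarMat (e : Mat q) := by rw [← hx, NormOne.isScalarMat_conj]; exact hns
  have he'S : partner e ∈ S :=
    Finset.mem_filter.2 ⟨mem_nonsplitTorus_iff.2 (partner_mem heE), partner_conj hns ⟨x, hx⟩⟩
  have hne : partner e ≠ e := partner_ne hq2 hnse
  have hSeq : S = {e, partner e} := by
    symm
    apply Finset.eq_of_subset_of_card_le
    · intro y hy
      rcases Finset.mem_insert.1 hy with rfl | hy
      · exact heS
      · rw [Finset.mem_singleton.1 hy]; exact he'S
    · rw [hScard, Finset.card_pair hne.symm]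
  -- Frobenius
  have key := frobenius_GL (torusSubgroup η) (torusChar hζ hη hq5) g
  rw [NormOne.card_centralizer_of_not_hasRatEigenvalue g hg] at key
  have hsum : ∑ y ∈ Finset.univ.filter (fun y : G q => ∃ x : G q, x⁻¹ * g * x = y), wt (torusSubgroup η) (torusChar hζ hη hq5) y =
      wt (torusSubgroup η) (torusChar hζ hη hq5) e + wt (torusSubgroup η) (torusChar hζ hη hq5) (partner e) := by
    apply Finset.sum_eq_add_of_mem e (partner e) (Finset.mem_filter.2 ⟨Finset.mem_univ _, x, hx⟩)
      (Finset.mem_filter.2 ⟨Finset.mem_univ _, partner_conj hns ⟨x, hx⟩⟩) hne.symm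
    rintro c hc ⟨hce, hce'⟩
    refine wt_of_not_mem _ _ (fun hcE => ?_)
    have hcS : c ∈ S := Finset.mem_filter.2 ⟨mem_nonsplitTorus_iff.2 hcE, (Finset.mem_filter.1 hc).2⟩
    rw [hSeq, Finset.mem_insert, Finset.mem_singleton] at hcS
    rcases hcS with h | h
    · exact hce h
    · exact hce' h
  rw [hsum, wt_of_mem _ _ heE, wt_of_mem _ _ (partner_mem heE), torusChar_apply, torusChar_apply, torusCubic_partner hζ hη hq5 hq3 heE,
    ← map_inv] at key
  unfold torusCubic at key
  rw [val_add_val_inv] at key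
  have htest : cubicChar (torusSubgroup_isCyclic hη) hζ (three_dvd_card_torus hη hq5) ⟨e, heE⟩ = 1 ↔
      (g : Mat q) ^ ((q - 1) * (q + 1) / 3) = 1 := by
    have h1 := torusCubic_eq_one_iff hζ hη hq5 ⟨e, heE⟩
    unfold torusCubic at h1
    rw [h1]
    show (e : Mat q) ^ ((q - 1) * (q + 1) / 3) = 1 ↔ _
    rw [← hx, ← Units.val_pow_eq_pow_val, show x⁻¹ * g * x = x⁻¹ * g * x⁻¹⁻¹ by rw [inv_inv], conj_pow, Units.val_mul, Units.val_mul,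
      Units.val_pow_eq_pow_val, PS.conj_eq_one_iff]
  have hcard : (((q - 1) * (q + 1) : ℕ) : k) = ((q : k) - 1) * ((q : k) + 1) := by
    rw [Nat.cast_mul, Nat.cast_sub (Fact.out : q.Prime).one_lt.le, Nat.cast_one, Nat.cast_add, Nat.cast_one]
  rw [hcard] at key
  apply mul_left_cancel₀ (card_torus_ne_zero (k := k) hη)
  rw [key, card_torus_cast hη]
  by_cases h : (g : Mat q) ^ ((q - 1) * (q + 1) / 3) = 1
  · rw [if_pos h, if_pos (htest.2 h)]
  · rw [if_neg h, if_neg (fun h' => h (htest.1 h'))]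

end Summit.BirchSwinnertonDyer.BirchSwinnertonDyer.Theorems.CartanSupply.Monomial

end
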